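/-
Copyright (c) 2026 the pub-hodgecm-mathlib formalisation cell (harness21).  Prover seat hodgecm-mathlib-K2E3-p26 (g4) (chair K2-lead (g2) VALVE 41 → S8 dealer R90-CS-plan (g4),
S8-R287 (1), walk-in W10), R90-TF section S8 «ContSpec-n½», road R2-χ₃, the `hsrc` row at the moved base point: THE `ξ.ψ ∘ det` FACTOR OF THE PAIR BLOCK'S FINITE READING
IS ONE GLOBAL CONSTANT (K2E1-p11 (g6)'s one line, R90 bus 2026-09-05T04:11Z).  THEOREMS ONLY.
-/
import Summits.HodgeConjecture.HodgeConjecture.Theorems.K2E1ChiUnfoldingArchPhaseOfRecordU3   -- ★ p864717 (K2E1-p13): `coe_det_adelicVal_archToAdelic_archPart`; brings ★ `adelicDet_eq_one_of_mem_adelicUnipotent`, `archToAdelic_mul_finAdelicToAdelic`, `coe_coe_weylLongU_three`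
import Literature.NumberTheory.Automorphic.UnitaryGroupDetCharacter                            -- ★ `detChar`, `detChar_apply` (`(ψ ∘ det)(g) = ψ(det g)`)
import Literature.NumberTheory.Automorphic.UnitaryGroupArchLatticeJunction                      -- ★ `finPart_toAdelic` (`(ι γ)_f = γ_f`); brings ★ `rationalToFinAdelic`, `coe_rationalToFinAdelic`
import HarnessLib

/-!
# R90·S8 ∕ K2·E1 — `R90S8TorusDictLocalUnitsPsiFactorU3`: the `Θ = ξ.ψ ∘ det` factor of the pair block's finite reading `Φ_f^{pair} = (φ₀ ∘ ι_f)·(Θ ∘ ι_f)` is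
# CONSTANT along the big cell, and equals `1` at the moved base point when `ψ` kills the off-`S₀` integral torus

Cell `pub/hodgecm-mathlib`, crux h413 = `stmt-HodgeConjecture-24833`, route of record `HCCMUnconditional`; R90-TF section S8 «ContSpec-n½», road R2-χ₃ (the `hsrc` row OF RECORD
at the moved base point).  THEOREMS ONLY (no `def`, no `instance`, no notation, no named-fact hypothesis, no `sorry`; default heartbeats); lane
`--supports stmt-HodgeConjecture-24833 --as helper` (count-neutral).  Closes no socket.

THE SLOT.  K2E1-p13 (g6)'s assembler `R90S8MidWitnessSrc16OfCoreLettersU3.hsrc16_of_coreLetters_at` binds the pure-tensor letter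
`hΩ : ∀ x, φ₀(ι_f(U x)) · Θ(ι_f(U x)) = ∏ᶠ_v ω_v(x_v)` with `U x := (ι(w₀)·u(x))_f · b₁` (`u(x) ∈ N(𝔸)` the Heisenberg chart) and `Θ := detChar … ξ.ψ ξ.hψ …` (`= ξ.ψ ∘ det`, ★
`UnitaryGroupDetCharacter`).  K2E1-p11 (g6)'s ONE LINE (ledger `R90/S8/LEDGER-hsrc-core-letters.K2E1-p11-g6.md` (e) row, superseded 04:11Z): the `Θ`-factor is ONE GLOBAL
CONSTANT `θ₀`, because `det` of a unipotent element is `1`: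
* §1 **`detChar_finAdelicToAdelic_finPart_unipotent`** — `Θ((u)_f) = 1` for `u ∈ N(𝔸)` (`u = (u_∞, 1)·(1, u_f)`, ★ `archToAdelic_mul_finAdelicToAdelic`; `det u = 1` ★
  `adelicDet_eq_one_of_mem_adelicUnipotent`; `det (u_∞, 1) = ((det u)_∞, 1) = 1` ★ `coe_det_adelicVal_archToAdelic_archPart`); hence
  **`detChar_finReading_const`** — `Θ(ι_f((g·u)_f · b)) = Θ(ι_f(g_f · b))` for every `g ∈ U(2,1)(𝔸)`, `u ∈ N(𝔸)`, `b ∈ U(2,1)(𝔸_f)`: the reading's `Θ`-factor does not see `x`.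
* §2 the norm-one idele `t(X) := det (1, X_f)` of a finite reading has `t_∞ = 1` (**`fst_coe_adelicOneEquivTorus_adelicDet_finAdelicToAdelic`**) and `t_w = det X_w`
  (**`snd_coe_adelicOneEquivTorus_adelicDet_finAdelicToAdelic_apply`**), and `det ((ι w₀)_f · b)_w = −det b_w` (**`det_evalAt_finPart_weylLongU_mul`**); hence
  **`detChar_finPart_weylLongU_mul_eq_one_of_offIntegralTorus`** — at the moved base point `b₁ = w₀^{S₀}` (★ p865348 `exists_movedBasePoint`: `((b₁)_v)_w = Φ₃` on `S₀`, `= 1` off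
  `S₀`) the constant `θ₀ = Θ(ι_f((ι w₀)_f · b₁))` is `ψ` at the torus idele `t` with `t_∞ = 1`, `t_w = det Φ₃ · det Φ₃ = 1` above `S₀` and `t_w = det Φ₃ = −1` off `S₀`; so `θ₀ = 1`
  under the honest visible level hypothesis `hψS₀` «`ψ` kills the off-`S₀` integral torus» (every `t ∈ T(𝔸_{L⁺})` with `t_∞ = 1`, `t_w = 1` above `S₀`, `|t_w|_w = 1` everywhere).
  Without `hψS₀`, `θ₀` is the sign `ψ(t)` (the (V) road's free constant absorbs it; ★ p864821's rigid constant cannot) — K2E1-p11's verdict «root of unity vs 1».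
HONEST LABEL: HC_CM is proved only modulo the 7 printed citations (2 remaining named inputs: hLiu418 = `stmt-HodgeConjecture-24832`, h413 = `stmt-HodgeConjecture-24833`) until rung 0
closes; REL ≠ ★ ≠ BUILT; this file asserts no named fact and closes no socket; with §1–§2 the assembler's `hΩ` reduces to the `ψ`-free reading of ★ p864965 modulo `hψS₀`; count-neutral.

## References
* [Rogawski1990] J. D. Rogawski, *Automorphic Representations of Unitary Groups in Three Variables*, Ann. of Math. Stud. 123 (1990): §1.10 p. 9 (`w₀`, `det`), §13.3 p. 202 (`ψ ∘ det`).
* [BorelJacquet1979] A. Borel, H. Jacquet, *Automorphic forms and automorphic representations*, PSPM 33.1 (1979): §4.1 (`G(𝔸) = G_∞ × G(𝔸_f)`).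
* [TateThesis1967] J. Tate, in Cassels–Fröhlich (1967): §3.2 (characters of restricted products), §4.3.
-/

set_option autoImplicit false
set_option linter.dupNamespace false -- the mandated namespace repeats `HodgeConjecture.HodgeConjecture`

noncomputable section

open NumberField NumberField.InfinitePlace IsDedekindDomain
open Literature.NumberTheory.Automorphic Literature.NumberTheory.Automorphic.UnitaryGroup Literature.NumberTheory.GaloisRepresentations AdelicGroupData
open Literature.NumberTheory.Automorphic.Arthur2013.Leaves.TECR
open Literature.NumberTheory.Automorphic.UnitaryGroup.AdelicCharactersDetQuasiSplit (antidiagonal_over_det_ne_zero)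
open Summit.HodgeConjecture.HodgeConjecture.Cruxes.H413
open Summit.HodgeConjecture.HodgeConjecture.Cruxes.H413.K2E1ChiDetCharTorusDescentU2 (adelicDet_eq_one_of_mem_adelicUnipotent)
open Summit.HodgeConjecture.HodgeConjecture.Cruxes.H413.K2E1ChiUnfoldingArchPhaseOfRecordU3 (coe_det_adelicVal_archToAdelic_archPart)
open Summit.HodgeConjecture.HodgeConjecture.R90.S8

namespace Summit.HodgeConjecture.HodgeConjecture.Cruxes.H413.R90S8TorusDictLocalUnitsPsiFactorU3

variable (L : Type) [Field L] [NumberField L] [IsCMField L]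
  (h2 : Module.finrank (↥(maximalRealSubfield L)) L = 2) (hc1 : IsCMField.complexConj L ≠ 1)
  (ψ : ↥(TorusDict.torus (IsCMField.complexConj L)) →ₜ* ℂˣ) (hψ : TorusDict.IsAutomorphic (IsCMField.complexConj L) ψ)

/-! ## §1 `Θ = ψ ∘ det` does not see the unipotent factor of the finite reading -/

/-- **`(ψ ∘ det)((u)_f) = 1` for `u ∈ N(𝔸)`**: `u = (u_∞, 1)·(1, u_f)`, `det u = 1` and `det (u_∞, 1) = ((det u)_∞, 1) = 1`, so `(ψ ∘ det)(1, u_f) = (ψ ∘ det)(u_∞, 1)⁻¹ · (ψ ∘ det)(u) = 1`.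
[cite: Rogawski1990, §1.10 p. 9, §13.3 p. 202] [cite: BorelJacquet1979, §4.1] -/
theorem detChar_finAdelicToAdelic_finPart_unipotent (u : ↥(adelicUnipotent (↥(maximalRealSubfield L)) L (IsCMField.complexConj L) 3)) :
    detChar (↥(maximalRealSubfield L)) L (IsCMField.complexConj L) h2 hc1 3 ((StdForm.antidiagonal 3).over L) ψ hψ (antidiagonal_over_det_ne_zero L 3)
        (finAdelicToAdelic (↥(maximalRealSubfield L)) L (IsCMField.complexConj L) 3 ((StdForm.antidiagonal 3).over L)
          (finPart (↥(maximalRealSubfield L)) L (IsCMField.complexConj L) 3 ((StdForm.antidiagonal 3).over L) (u : (quasiSplit (↥(maximalRealSubfield L)) L (IsCMField.complexConj L) 3).Adelic))) = 1 := by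
  -- `det u = 1` as an adele
  have hdet1 : (((Matrix.GeneralLinearGroup.det (adelicVal (↥(maximalRealSubfield L)) L (IsCMField.complexConj L) 3 ((StdForm.antidiagonal 3).over L)
      (u : (quasiSplit (↥(maximalRealSubfield L)) L (IsCMField.complexConj L) 3).Adelic))) : (AdeleRing (𝓞 L) L)ˣ) : AdeleRing (𝓞 L) L) = 1 := by
    have h := congrArg (fun x : ↥(adelicOne (↥(maximalRealSubfield L)) L (IsCMField.complexConj L)) => ((x : (AdeleRing (𝓞 L) L)ˣ) : AdeleRing (𝓞 L) L))
      (adelicDet_eq_one_of_mem_adelicUnipotent (antidiagonal_over_det_ne_zero L 3) u.2)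
    simpa only [coe_adelicDet, OneMemClass.coe_one, Units.val_one, adelicVal_apply] using h
  -- `(ψ ∘ det)(u) = 1`
  have hu : detChar (↥(maximalRealSubfield L)) L (IsCMField.complexConj L) h2 hc1 3 ((StdForm.antidiagonal 3).over L) ψ hψ (antidiagonal_over_det_ne_zero L 3)
      (u : (quasiSplit (↥(maximalRealSubfield L)) L (IsCMField.complexConj L) 3).Adelic) = 1 := by
    rw [UnitaryGroup.detChar_apply, adelicDet_eq_one_of_mem_adelicUnipotent (antidiagonal_over_det_ne_zero L 3) u.2, map_one, map_one]
  -- `(ψ ∘ det)(u_∞, 1) = 1`: its determinant is `((det u)_∞, 1) = 1`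
  have harch : detChar (↥(maximalRealSubfield L)) L (IsCMField.complexConj L) h2 hc1 3 ((StdForm.antidiagonal 3).over L) ψ hψ (antidiagonal_over_det_ne_zero L 3)
      (archToAdelic (↥(maximalRealSubfield L)) L (IsCMField.complexConj L) 3 ((StdForm.antidiagonal 3).over L)
        (archPart (↥(maximalRealSubfield L)) L (IsCMField.complexConj L) 3 ((StdForm.antidiagonal 3).over L) (u : (quasiSplit (↥(maximalRealSubfield L)) L (IsCMField.complexConj L) 3).Adelic))) = 1 := by
    have hd : adelicDet (↥(maximalRealSubfield L)) L (IsCMField.complexConj L) 3 ((StdForm.antidiagonal 3).over L) (antidiagonal_over_det_ne_zero L 3)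
        (archToAdelic (↥(maximalRealSubfield L)) L (IsCMField.complexConj L) 3 ((StdForm.antidiagonal 3).over L)
          (archPart (↥(maximalRealSubfield L)) L (IsCMField.complexConj L) 3 ((StdForm.antidiagonal 3).over L) (u : (quasiSplit (↥(maximalRealSubfield L)) L (IsCMField.complexConj L) 3).Adelic))) = 1 := by
      refine Subtype.ext (Units.ext ?_)
      have h := coe_det_adelicVal_archToAdelic_archPart L (u : (quasiSplit (↥(maximalRealSubfield L)) L (IsCMField.complexConj L) 3).Adelic)
      rw [hdet1] at h
      rw [coe_adelicDet, OneMemClass.coe_one, Units.val_one]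
      exact h
    rw [UnitaryGroup.detChar_apply, hd, map_one, map_one]
  have hmul := map_mul (detChar (↥(maximalRealSubfield L)) L (IsCMField.complexConj L) h2 hc1 3 ((StdForm.antidiagonal 3).over L) ψ hψ (antidiagonal_over_det_ne_zero L 3))
    (archToAdelic (↥(maximalRealSubfield L)) L (IsCMField.complexConj L) 3 ((StdForm.antidiagonal 3).over L)
      (archPart (↥(maximalRealSubfield L)) L (IsCMField.complexConj L) 3 ((StdForm.antidiagonal 3).over L) (u : (quasiSplit (↥(maximalRealSubfield L)) L (IsCMField.complexConj L) 3).Adelic)))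
    (finAdelicToAdelic (↥(maximalRealSubfield L)) L (IsCMField.complexConj L) 3 ((StdForm.antidiagonal 3).over L)
      (finPart (↥(maximalRealSubfield L)) L (IsCMField.complexConj L) 3 ((StdForm.antidiagonal 3).over L) (u : (quasiSplit (↥(maximalRealSubfield L)) L (IsCMField.complexConj L) 3).Adelic)))
  rw [archToAdelic_mul_finAdelicToAdelic, hu, harch, one_mul] at hmul
  exact hmul.symm

/-- **THE `Θ`-FACTOR OF THE FINITE READING IS CONSTANT ALONG THE BIG CELL**: `Θ(ι_f((g·u)_f · b)) = Θ(ι_f(g_f · b))` for `g ∈ U(2,1)(𝔸_{L⁺})`, `u ∈ N(𝔸)`, `b ∈ U(2,1)(𝔸_{L⁺,f})`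
(`Θ = ψ ∘ det`; at `g := ι(w₀)`, `u := u(x)` the Heisenberg chart, `b := b₁` this is the `x`-independence of the `Θ`-factor in K2E1-p13's `hΩ`).
[cite: Rogawski1990, §1.10 p. 9, §13.3 p. 202] [cite: BorelJacquet1979, §4.1] -/
theorem detChar_finReading_const (g : (quasiSplit (↥(maximalRealSubfield L)) L (IsCMField.complexConj L) 3).Adelic)
    (u : ↥(adelicUnipotent (↥(maximalRealSubfield L)) L (IsCMField.complexConj L) 3))
    (b : ↥(finAdelic (↥(maximalRealSubfield L)) L (IsCMField.complexConj L) 3 ((StdForm.antidiagonal 3).over L))) :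
    detChar (↥(maximalRealSubfield L)) L (IsCMField.complexConj L) h2 hc1 3 ((StdForm.antidiagonal 3).over L) ψ hψ (antidiagonal_over_det_ne_zero L 3)
        (finAdelicToAdelic (↥(maximalRealSubfield L)) L (IsCMField.complexConj L) 3 ((StdForm.antidiagonal 3).over L)
          (finPart (↥(maximalRealSubfield L)) L (IsCMField.complexConj L) 3 ((StdForm.antidiagonal 3).over L)
              (g * (u : (quasiSplit (↥(maximalRealSubfield L)) L (IsCMField.complexConj L) 3).Adelic)) * b)) =
      detChar (↥(maximalRealSubfield L)) L (IsCMField.complexConj L) h2 hc1 3 ((StdForm.antidiagonal 3).over L) ψ hψ (antidiagonal_over_det_ne_zero L 3)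
        (finAdelicToAdelic (↥(maximalRealSubfield L)) L (IsCMField.complexConj L) 3 ((StdForm.antidiagonal 3).over L)
          (finPart (↥(maximalRealSubfield L)) L (IsCMField.complexConj L) 3 ((StdForm.antidiagonal 3).over L) g * b)) := by
  rw [map_mul (finPart (↥(maximalRealSubfield L)) L (IsCMField.complexConj L) 3 ((StdForm.antidiagonal 3).over L)), mul_assoc, map_mul, map_mul, map_mul, map_mul,
    detChar_finAdelicToAdelic_finPart_unipotent, one_mul, ← map_mul, ← map_mul]

/-! ## §2 The idele `det (1, X_f)` of a finite reading, and `θ₀ = 1` at the moved base point -/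

/-- **The norm-one idele `det (1, X_f) ∈ T(𝔸_{L⁺})` has archimedean component `1`** for every `X ∈ U(2,1)(𝔸_{L⁺,f})` (`(1, X_f)_∞ = 1`, ★ `map_fst_ofFinite`; the torus
dictionary ★ `adelicOneEquivTorus` is the identity on ideles). [cite: BorelJacquet1979, §4.1] -/
theorem fst_coe_adelicOneEquivTorus_adelicDet_finAdelicToAdelic (X : ↥(finAdelic (↥(maximalRealSubfield L)) L (IsCMField.complexConj L) 3 ((StdForm.antidiagonal 3).over L))) :
    (((adelicOneEquivTorus (↥(maximalRealSubfield L)) L (IsCMField.complexConj L)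
        (adelicDet (↥(maximalRealSubfield L)) L (IsCMField.complexConj L) 3 ((StdForm.antidiagonal 3).over L) (antidiagonal_over_det_ne_zero L 3)
          (finAdelicToAdelic (↥(maximalRealSubfield L)) L (IsCMField.complexConj L) 3 ((StdForm.antidiagonal 3).over L) X)) :
        ↥(TorusDict.torus (IsCMField.complexConj L))) : ideleGroup L) : AdeleRing (𝓞 L) L).1 = 1 := by
  change adeleFst L (((Matrix.GeneralLinearGroup.det (GLn.ofFinite 3 L (X : GL (Fin 3) (FiniteAdeleRing (𝓞 L) L)))) : (AdeleRing (𝓞 L) L)ˣ) : AdeleRing (𝓞 L) L) = 1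
  rw [Matrix.GeneralLinearGroup.val_det_apply, RingHom.map_det, RingHom.mapMatrix_apply, map_fst_ofFinite, Matrix.det_one]

/-- **The norm-one idele `det (1, X_f) ∈ T(𝔸_{L⁺})` has `w`-component `det X_w`** at every finite place `w` of `L`, for every `X ∈ U(2,1)(𝔸_{L⁺,f})` (★ `map_snd_ofFinite`,
★ `map_eval_eq_evalAt`). [cite: BorelJacquet1979, §4.1] -/
theorem snd_coe_adelicOneEquivTorus_adelicDet_finAdelicToAdelic_apply (X : ↥(finAdelic (↥(maximalRealSubfield L)) L (IsCMField.complexConj L) 3 ((StdForm.antidiagonal 3).over L)))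
    (w : HeightOneSpectrum (𝓞 L)) :
    (((adelicOneEquivTorus (↥(maximalRealSubfield L)) L (IsCMField.complexConj L)
        (adelicDet (↥(maximalRealSubfield L)) L (IsCMField.complexConj L) 3 ((StdForm.antidiagonal 3).over L) (antidiagonal_over_det_ne_zero L 3)
          (finAdelicToAdelic (↥(maximalRealSubfield L)) L (IsCMField.complexConj L) 3 ((StdForm.antidiagonal 3).over L) X)) :
        ↥(TorusDict.torus (IsCMField.complexConj L))) : ideleGroup L) : AdeleRing (𝓞 L) L).2 w =
      (((GLn.evalAt 3 L w (X : GL (Fin 3) (FiniteAdeleRing (𝓞 L) L))) : GL (Fin 3) (w.adicCompletion L)) : Matrix (Fin 3) (Fin 3) (w.adicCompletion L)).det := by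
  change adeleSnd L (((Matrix.GeneralLinearGroup.det (GLn.ofFinite 3 L (X : GL (Fin 3) (FiniteAdeleRing (𝓞 L) L)))) : (AdeleRing (𝓞 L) L)ˣ) : AdeleRing (𝓞 L) L) w = _
  rw [Matrix.GeneralLinearGroup.val_det_apply, RingHom.map_det, RingHom.mapMatrix_apply, map_snd_ofFinite, ← finiteAdeleEval_apply L w,
    RingHom.map_det, RingHom.mapMatrix_apply, map_eval_eq_evalAt]

/-- **`det ((ι w₀)_f · b)_w = − det b_w`** at every finite place `w` of `L`, for every `b ∈ U(2,1)(𝔸_{L⁺,f})`: `(ι w₀)_f = (w₀)_f` (★ `finPart_toAdelic`) and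
`det w₀ = det antidiag(1,1,1) = −1` (★ `coe_coe_weylLongU_three`). [cite: Rogawski1990, §1.10 p. 9] [cite: BorelJacquet1979, §4.1] -/
theorem det_evalAt_finPart_weylLongU_mul (b : ↥(finAdelic (↥(maximalRealSubfield L)) L (IsCMField.complexConj L) 3 ((StdForm.antidiagonal 3).over L)))
    (w : HeightOneSpectrum (𝓞 L)) :
    ((GLn.evalAt 3 L w (((finPart (↥(maximalRealSubfield L)) L (IsCMField.complexConj L) 3 ((StdForm.antidiagonal 3).over L)
        ((quasiSplit (↥(maximalRealSubfield L)) L (IsCMField.complexConj L) 3).toAdelic (weylLongU ((IsCMField.complexConj L : L ≃ₐ[↥(maximalRealSubfield L)] L) : L →+* L)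
          (rfl : (StdForm.antidiagonal 3).over L = (StdForm.antidiagonal 3).over L))) * b :
        ↥(finAdelic (↥(maximalRealSubfield L)) L (IsCMField.complexConj L) 3 ((StdForm.antidiagonal 3).over L))) : GL (Fin 3) (FiniteAdeleRing (𝓞 L) L))) :
        GL (Fin 3) (w.adicCompletion L)) : Matrix (Fin 3) (Fin 3) (w.adicCompletion L)).det =
      -(((GLn.evalAt 3 L w (b : GL (Fin 3) (FiniteAdeleRing (𝓞 L) L))) : GL (Fin 3) (w.adicCompletion L)) : Matrix (Fin 3) (Fin 3) (w.adicCompletion L)).det := by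
  -- `det w₀ = -1` in `L`, then read in `L_w`
  have hL : (((weylLongU ((IsCMField.complexConj L : L ≃ₐ[↥(maximalRealSubfield L)] L) : L →+* L) (rfl : (StdForm.antidiagonal 3).over L = (StdForm.antidiagonal 3).over L) :
      ↥(unitaryGroupOfForm ((IsCMField.complexConj L : L ≃ₐ[↥(maximalRealSubfield L)] L) : L →+* L) ((StdForm.antidiagonal 3).over L))) : GL (Fin 3) L) : Matrix (Fin 3) (Fin 3) L).det = -1 := by
    rw [coe_coe_weylLongU_three, Matrix.det_fin_three]
    simp
  have hw₀ : ((((weylLongU ((IsCMField.complexConj L : L ≃ₐ[↥(maximalRealSubfield L)] L) : L →+* L) (rfl : (StdForm.antidiagonal 3).over L = (StdForm.antidiagonal 3).over L) :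
      ↥(unitaryGroupOfForm ((IsCMField.complexConj L : L ≃ₐ[↥(maximalRealSubfield L)] L) : L →+* L) ((StdForm.antidiagonal 3).over L))) : GL (Fin 3) L) : Matrix (Fin 3) (Fin 3) L).map
        ((finiteAdeleEval L w).comp (algebraMap L (FiniteAdeleRing (𝓞 L) L)))).det = -1 := by
    rw [← RingHom.mapMatrix_apply, ← RingHom.map_det, hL, map_neg, map_one]
  -- `(ι w₀)_f = (w₀)_f`
  have hfin : finPart (↥(maximalRealSubfield L)) L (IsCMField.complexConj L) 3 ((StdForm.antidiagonal 3).over L)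
      ((quasiSplit (↥(maximalRealSubfield L)) L (IsCMField.complexConj L) 3).toAdelic (weylLongU ((IsCMField.complexConj L : L ≃ₐ[↥(maximalRealSubfield L)] L) : L →+* L)
        (rfl : (StdForm.antidiagonal 3).over L = (StdForm.antidiagonal 3).over L))) =
      rationalToFinAdelic (↥(maximalRealSubfield L)) L (IsCMField.complexConj L) 3 ((StdForm.antidiagonal 3).over L)
        (weylLongU ((IsCMField.complexConj L : L ≃ₐ[↥(maximalRealSubfield L)] L) : L →+* L) (rfl : (StdForm.antidiagonal 3).over L = (StdForm.antidiagonal 3).over L)) :=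
    finPart_toAdelic (↥(maximalRealSubfield L)) L (IsCMField.complexConj L) 3 ((StdForm.antidiagonal 3).over L) _
  rw [Subgroup.coe_mul, map_mul, Units.val_mul, Matrix.det_mul, hfin, coe_rationalToFinAdelic]
  change (((((weylLongU ((IsCMField.complexConj L : L ≃ₐ[↥(maximalRealSubfield L)] L) : L →+* L) (rfl : (StdForm.antidiagonal 3).over L = (StdForm.antidiagonal 3).over L) :
      ↥(unitaryGroupOfForm ((IsCMField.complexConj L : L ≃ₐ[↥(maximalRealSubfield L)] L) : L →+* L) ((StdForm.antidiagonal 3).over L))) : GL (Fin 3) L) : Matrix (Fin 3) (Fin 3) L).map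
        (algebraMap L (FiniteAdeleRing (𝓞 L) L))).map (finiteAdeleEval L w)).det * _ = _
  rw [Matrix.map_map, ← RingHom.coe_comp, hw₀, neg_one_mul]

/-- **AT THE MOVED BASE POINT, `θ₀ = Θ(ι_f((ι w₀)_f · b₁)) = 1` WHEN `ψ` KILLS THE OFF-`S₀` INTEGRAL TORUS.**  For `b₁ = w₀^{S₀}` (★ p865348 `exists_movedBasePoint`: `((b₁)_v)_w = Φ₃`
above `v ∈ S₀`, `= 1` above `v ∉ S₀` — its two clauses are the hypotheses `hb₁S₀`, `hb₁off` VERBATIM) the idele `t := det (1, ((ι w₀)_f · b₁))` has `t_∞ = 1` (`fst_coe_adelicOneEquivTorus_adelicDet_finAdelicToAdelic`),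
`t_w = −det (b₁)_w` (`snd_coe_adelicOneEquivTorus_adelicDet_finAdelicToAdelic_apply`, `det_evalAt_finPart_weylLongU_mul`), i.e. `t_w = (−1)(−1) = 1` above `S₀` and `t_w = −1` (a unit) off `S₀`; so `Θ = ψ ∘ det`
(★ `detChar_apply`) takes the value `ψ(t) = 1` as soon as `ψ` kills every norm-one idele `t` with `t_∞ = 1`, `t_w = 1` above `S₀` and `|t_w|_w = 1` everywhere («`ψ` unramified outside `S₀`»,
the visible level hypothesis `hψS₀`, K2E1-p11 (g6) 2026-09-05T04:11Z).  Without `hψS₀`, `θ₀ = ψ(t)` is a sign.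
[cite: Rogawski1990, §1.10 p. 9, §13.3 p. 202] [cite: BorelJacquet1979, §4.1] [cite: TateThesis1967, §3.2] -/
theorem detChar_finPart_weylLongU_mul_eq_one_of_offIntegralTorus (S₀ : Finset (HeightOneSpectrum (𝓞 ↥(maximalRealSubfield L))))
    (hψS₀ : ∀ t : ↥(TorusDict.torus (IsCMField.complexConj L)), ((t : ideleGroup L) : AdeleRing (𝓞 L) L).1 = 1 →
      (∀ w : HeightOneSpectrum (𝓞 L), w.under (𝓞 ↥(maximalRealSubfield L)) ∈ S₀ → ((t : ideleGroup L) : AdeleRing (𝓞 L) L).2 w = 1) →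
      (∀ w : HeightOneSpectrum (𝓞 L), Valued.v (((t : ideleGroup L) : AdeleRing (𝓞 L) L).2 w) = 1) → ψ t = 1)
    {b₁ : ↥(finAdelic (↥(maximalRealSubfield L)) L (IsCMField.complexConj L) 3 ((StdForm.antidiagonal 3).over L))}
    (hb₁S₀ : ∀ v ∈ S₀, ∀ w : PlacesOver L v, ((((evalPlace (↥(maximalRealSubfield L)) L (IsCMField.complexConj L) 3 ((StdForm.antidiagonal 3).over L) v b₁ :
        localPi L (IsCMField.complexConj L) 3 ((StdForm.antidiagonal 3).over L) v) : LocalGLPi L 3 v) w : GL (Fin 3) (w.1.adicCompletion L)) : Matrix (Fin 3) (Fin 3) (w.1.adicCompletion L)) =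
      !![0, 0, 1; 0, 1, 0; 1, 0, 0])
    (hb₁off : ∀ v ∉ S₀, ∀ w : PlacesOver L v, ((((evalPlace (↥(maximalRealSubfield L)) L (IsCMField.complexConj L) 3 ((StdForm.antidiagonal 3).over L) v b₁ :
        localPi L (IsCMField.complexConj L) 3 ((StdForm.antidiagonal 3).over L) v) : LocalGLPi L 3 v) w : GL (Fin 3) (w.1.adicCompletion L)) : Matrix (Fin 3) (Fin 3) (w.1.adicCompletion L)) = 1) :
    detChar (↥(maximalRealSubfield L)) L (IsCMField.complexConj L) h2 hc1 3 ((StdForm.antidiagonal 3).over L) ψ hψ (antidiagonal_over_det_ne_zero L 3)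
        (finAdelicToAdelic (↥(maximalRealSubfield L)) L (IsCMField.complexConj L) 3 ((StdForm.antidiagonal 3).over L)
          (finPart (↥(maximalRealSubfield L)) L (IsCMField.complexConj L) 3 ((StdForm.antidiagonal 3).over L)
              ((quasiSplit (↥(maximalRealSubfield L)) L (IsCMField.complexConj L) 3).toAdelic (weylLongU ((IsCMField.complexConj L : L ≃ₐ[↥(maximalRealSubfield L)] L) : L →+* L)
                (rfl : (StdForm.antidiagonal 3).over L = (StdForm.antidiagonal 3).over L))) * b₁)) = 1 := by
  -- the local determinants of `b₁`: `det Φ₃ = -1` above `S₀`, `det 1 = 1` off `S₀`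
  have hS : ∀ w : HeightOneSpectrum (𝓞 L), w.under (𝓞 ↥(maximalRealSubfield L)) ∈ S₀ →
      (((GLn.evalAt 3 L w (b₁ : GL (Fin 3) (FiniteAdeleRing (𝓞 L) L))) : GL (Fin 3) (w.adicCompletion L)) : Matrix (Fin 3) (Fin 3) (w.adicCompletion L)).det = -1 := fun w hw => by
    have h : (((GLn.evalAt 3 L w (b₁ : GL (Fin 3) (FiniteAdeleRing (𝓞 L) L))) : GL (Fin 3) (w.adicCompletion L)) : Matrix (Fin 3) (Fin 3) (w.adicCompletion L)) =
        !![0, 0, 1; 0, 1, 0; 1, 0, 0] := hb₁S₀ _ hw ⟨w, rfl⟩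
    rw [h, Matrix.det_fin_three]
    simp
  have hoff : ∀ w : HeightOneSpectrum (𝓞 L), w.under (𝓞 ↥(maximalRealSubfield L)) ∉ S₀ →
      (((GLn.evalAt 3 L w (b₁ : GL (Fin 3) (FiniteAdeleRing (𝓞 L) L))) : GL (Fin 3) (w.adicCompletion L)) : Matrix (Fin 3) (Fin 3) (w.adicCompletion L)).det = 1 := fun w hw => by
    have h : (((GLn.evalAt 3 L w (b₁ : GL (Fin 3) (FiniteAdeleRing (𝓞 L) L))) : GL (Fin 3) (w.adicCompletion L)) : Matrix (Fin 3) (Fin 3) (w.adicCompletion L)) = 1 :=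
      hb₁off _ hw ⟨w, rfl⟩
    rw [h, Matrix.det_one]
  rw [UnitaryGroup.detChar_apply]
  apply hψS₀
  · exact fst_coe_adelicOneEquivTorus_adelicDet_finAdelicToAdelic L _
  · intro w hw
    rw [snd_coe_adelicOneEquivTorus_adelicDet_finAdelicToAdelic_apply, det_evalAt_finPart_weylLongU_mul, hS w hw, neg_neg]
  · intro w
    rw [snd_coe_adelicOneEquivTorus_adelicDet_finAdelicToAdelic_apply, det_evalAt_finPart_weylLongU_mul]
    by_cases hw : w.under (𝓞 ↥(maximalRealSubfield L)) ∈ S₀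
    · rw [hS w hw, neg_neg, Valuation.map_one]
    · rw [hoff w hw, Valuation.map_neg, Valuation.map_one]

end Summit.HodgeConjecture.HodgeConjecture.Cruxes.H413.R90S8TorusDictLocalUnitsPsiFactorU3

end
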